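import Summits.FinalStateConjecture.FinalStateConjecture.Theses.SwallowTheDatum
import Summits.FinalStateConjecture.FinalStateConjecture.Theorems.SwallowTheDatumUniversalWitnessFamilyStubSheetCauchyCones
import Literature.Geometry.Lorentzian.ModelData
import Literature.Geometry.Lorentzian.MinkowskiCauchy
import HarnessLib

/-!
# Crux `SwallowTheDatum.UniversalWitnessFamily` (stmt-FinalStateConjecture-10051), line `Sketch`
# (throat-settles-too), stub `stub_sheetCauchy`

**The static slice `{t = 0}` of the Schwarzschild exterior `{r > 2M}`, realised in ingoing
Kerr–Schild coordinates as `Kerr.region 0 (Kerr.rPlus M 0)` with the metric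
`Kerr.smoothMetric M 0 (2M) = η + (2M/r) ℓ ⊗ ℓ`, `ℓ = (1, x⃗/r)`, and the time orientation
`V = −g♯dt*`, is a Cauchy hypersurface** in O'Neill's sense (`IsCauchyHypersurface`: met exactly
once by every endless timelike curve).  Here the slice is the image of the static slice map
`ψ(y) = (2M log(r/2M − 1), (1 + M/2ρ)² y)` of the open isotropic sheet `{‖y‖ > M/2}`, i.e. the
level set `{t = 0}` of static time `t = t* − 2M log(r/2M − 1)` (`mem_range_iff_staticTime`).

Proof.  Along a future timelike curve of the exterior the retarded and advanced times
`u = t* − r − 4M log(r/2M − 1)`, `v = t* + r` and static time `t = (u + v)/2` are strictly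
increasing (part 1, `SwallowTheDatumUniversalWitnessFamilyStubSheetCauchyCones`): at most one
crossing.  The curve is a future timelike curve of Minkowski space (the cones of `g` are narrower
than those of `η`), so the Minkowski estimate `‖Δx⃗‖ ≤ Δt*` (`Minkowski.norm_spatial_sub_le`)
applies: a bound on `t*` in the future (past) direction gives a future (past) endpoint in `E4`
(`exists_hasFutureEndpoint_of_time_le`, `exists_hasPastEndpoint_of_le_time`).  If `t ≤ T₁` along
the curve then `u, v` are bounded above (`u + v ≤ 2T₁`, both nondecreasing), so `t* < v` is
bounded above and the curve converges in `E4` towards its future end; the limit has `r > 2M`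
because `u → +∞` as `r → 2M⁺` at bounded `t*` (`lt_spatialNorm_of_tendsto`), so it is a future
endpoint in the exterior — excluded for an endless curve (`exists_lt_staticTime`).  Time-dually
`t` is unbounded below (`exists_staticTime_lt`).  By the intermediate value theorem `t` vanishes
exactly once (`stub_sheetCauchy`).

References: M. D. Kruskal, Phys. Rev. 119 (1960) 1743; B. O'Neill, *Semi-Riemannian geometry*
(1983), Ch. 14, Def. 14.28 and p. 415; R. M. Wald, *General Relativity* (1984), §6.4;
S. W. Hawking, G. F. R. Ellis (1973), §5.5, §6.2; C. W. Misner, K. S. Thorne, J. A. Wheeler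
(1973), §31.7, (31.22).
-/

set_option linter.dupNamespace false

noncomputable section

open scoped Manifold ContDiff Topology InnerProductSpace
open Set Function Filter Literature.Geometry.Lorentzian

namespace Summit.FinalStateConjecture.FinalStateConjecture.Theorems.SwallowTheDatum.UniversalWitnessFamily

namespace SheetCauchy

/-! ## Endpoints: a bounded Kerr–Schild time forces an endpoint in `E4` -/

/-- Along a future timelike curve of Minkowski space on an interval whose time coordinate is
bounded above, the curve has a future endpoint in `E4` (monotone bounded `t*` converges and the
spatial part is Cauchy, `Minkowski.norm_spatial_sub_le`). Hawking–Ellis 1973, §6.2; O'Neill 1983,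
Ch. 14, p. 415. -/
theorem exists_hasFutureEndpoint_of_time_le {c : ℝ → E4} {s : Set ℝ} (hs : s.OrdConnected)
    (hne : s.Nonempty)
    (h : Minkowski.spacetime.metric.IsFutureTimelikeCurveOn Minkowski.spacetime.timeOrientation c s)
    {B : ℝ} (hB : ∀ σ ∈ s, c σ 0 ≤ B) : ∃ p : E4, HasFutureEndpoint c s p := by
  haveI : Nonempty s := hne.to_subtype
  have hmono : Monotone fun σ : s ↦ c σ 0 :=
    monotoneOn_iff_monotone.mp (Minkowski.strictMonoOn_time hs h).monotoneOn
  have hb' : BddAbove (range fun σ : s ↦ c σ 0) := ⟨B, by rintro _ ⟨σ, rfl⟩; exact hB σ σ.2⟩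
  obtain ⟨⟨T, hT⟩, q, hq⟩ := Minkowski.tendsto_of_monotone_of_dist_le hmono hb'
    (fun i j hij ↦ by
      rw [dist_eq_norm]
      exact Minkowski.norm_spatial_sub_le hs h i.2 j.2 hij)
  exact ⟨E4.ofTimeSpace T q, Minkowski.tendsto_of_tendsto_time_spatial hT hq⟩

/-- Along a future timelike curve of Minkowski space on an interval whose time coordinate is
bounded below, the curve has a past endpoint in `E4` (time dual of
`exists_hasFutureEndpoint_of_time_le`, run on the order dual of the parameter interval).
Hawking–Ellis 1973, §6.2; O'Neill 1983, Ch. 14, p. 415. -/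
theorem exists_hasPastEndpoint_of_le_time {c : ℝ → E4} {s : Set ℝ} (hs : s.OrdConnected)
    (hne : s.Nonempty)
    (h : Minkowski.spacetime.metric.IsFutureTimelikeCurveOn Minkowski.spacetime.timeOrientation c s)
    {B : ℝ} (hB : ∀ σ ∈ s, B ≤ c σ 0) : ∃ p : E4, HasPastEndpoint c s p := by
  haveI : Nonempty s := hne.to_subtype
  have hmono : Monotone fun σ : sᵒᵈ ↦ -c (OrderDual.ofDual σ).1 0 := by
    intro i j hij
    have := (Minkowski.strictMonoOn_time hs h).monotoneOn (OrderDual.ofDual j).2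
      (OrderDual.ofDual i).2 (OrderDual.ofDual_le_ofDual.mpr hij)
    simpa using this
  have hb' : BddAbove (range fun σ : sᵒᵈ ↦ -c (OrderDual.ofDual σ).1 0) := by
    refine ⟨-B, ?_⟩
    rintro _ ⟨σ, rfl⟩
    have := hB (OrderDual.ofDual σ).1 (OrderDual.ofDual σ).2
    simpa using this
  obtain ⟨⟨T, hT⟩, q, hq⟩ := Minkowski.tendsto_of_monotone_of_dist_le hmono hb'
    (x := fun σ : sᵒᵈ ↦ E4.spatial (c (OrderDual.ofDual σ).1))
    (fun i j hij ↦ by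
      rw [dist_comm, dist_eq_norm]
      have := Minkowski.norm_spatial_sub_le hs h (OrderDual.ofDual j).2 (OrderDual.ofDual i).2
        (OrderDual.ofDual_le_ofDual.mpr hij)
      linarith)
  have hT' : Tendsto (fun σ : sᵒᵈ ↦ c (OrderDual.ofDual σ).1 0) atTop (𝓝 (-T)) := by
    simpa using hT.neg
  exact ⟨_, Minkowski.tendsto_of_tendsto_time_spatial hT' hq⟩

/-- **No exit through the future horizon at bounded retarded time.** If chart points `f i` of the
exterior `{r > 2M}` converge in `E4` along a filter while the retarded time `u(f i)` stays bounded
above, the limit lies in the exterior: as `r → 2M⁺` at convergent `t*`,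
`u = t* − r − 4M log(r/2M − 1) → +∞`. Wald 1984, §6.4 (the future horizon is `u = +∞`). -/
theorem lt_spatialNorm_of_tendsto {M : ℝ} (hM : 0 < M) {ι : Type*} {l : Filter ι} [l.NeBot]
    {f : ι → E4} {p : E4} (hf : Tendsto f l (𝓝 p)) (hr : ∀ i, 2 * M < E4.spatialNorm (f i))
    {B : ℝ} (hU : ∀ᶠ i in l, f i 0 - E4.spatialNorm (f i) -
      4 * M * Real.log (E4.spatialNorm (f i) / (2 * M) - 1) ≤ B) : 2 * M < E4.spatialNorm p := by
  have hcont : Continuous E4.spatialNorm := continuous_norm.comp E4.spatial.continuous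
  have hrt : Tendsto (fun i ↦ E4.spatialNorm (f i)) l (𝓝 (E4.spatialNorm p)) :=
    (hcont.tendsto p).comp hf
  have hle : 2 * M ≤ E4.spatialNorm p := ge_of_tendsto hrt (Eventually.of_forall fun i ↦ (hr i).le)
  refine lt_of_le_of_ne hle fun heq ↦ ?_
  have h2M : (0 : ℝ) < 2 * M := by linarith
  have h1 : Tendsto (fun i ↦ E4.spatialNorm (f i) / (2 * M) - 1) l (𝓝[>] 0) := by
    refine tendsto_nhdsWithin_iff.2 ⟨?_, Eventually.of_forall fun i ↦ ?_⟩
    · have := (hrt.div_const (2 * M)).sub_const 1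
      rwa [← heq, div_self h2M.ne', sub_self] at this
    · show 0 < E4.spatialNorm (f i) / (2 * M) - 1
      rw [sub_pos, one_lt_div h2M]
      exact hr i
  have h2 : Tendsto (fun i ↦ Real.log (E4.spatialNorm (f i) / (2 * M) - 1)) l atBot :=
    Real.tendsto_log_nhdsGT_zero.comp h1
  have h0 : Tendsto (fun i ↦ f i 0) l (𝓝 (p 0)) :=
    ((EuclideanSpace.proj (0 : Fin 4) : E4 →L[ℝ] ℝ).continuous.tendsto p).comp hf
  have h3 : Tendsto (fun i ↦ f i 0 - E4.spatialNorm (f i) -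
      4 * M * Real.log (E4.spatialNorm (f i) / (2 * M) - 1)) l atTop := by
    have h4 := (h0.sub hrt).add_atTop (h2.const_mul_atBot_of_neg (by linarith : -(4 * M) < 0))
    refine h4.congr' (Eventually.of_forall fun i ↦ ?_)
    ring
  obtain ⟨i, hi1, hi2⟩ := (hU.and (h3.eventually_gt_atTop B)).exists
  exact absurd hi2 (not_lt.mpr hi1)

/-! ## Static time is unbounded above and below along endless timelike curves -/

/-- **Static time is unbounded above along a future endless timelike curve of the exterior.**
If `t ≤ T₁` on the domain then, with `u₀, v₀` the retarded/advanced times at a chosen parameter,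
`v ≤ 2T₁ − u₀` and `u ≤ 2T₁ − v₀` on the whole domain (both are nondecreasing and `u + v = 2t`),
so `t* < v` is bounded above, the curve converges in `E4` towards its future end
(`exists_hasFutureEndpoint_of_time_le`), and the limit lies in `{r > 2M}`
(`lt_spatialNorm_of_tendsto`): a future endpoint, contradicting endlessness. O'Neill 1983,
Ch. 14, Def. 14.28; Wald 1984, §6.4. -/
theorem exists_lt_staticTime {M : ℝ} [Kerr.Facts] (hM : 0 < M)
    {γ : ℝ → Kerr.region 0 (Kerr.rPlus M 0)} {s : Set ℝ} (hs : s.OrdConnected)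
    (hγ : (Kerr.smoothMetric M 0 (Kerr.rPlus M 0)).IsFutureTimelikeCurveOn
      ((Kerr.timeOrientation M 0 (Kerr.rPlus M 0) hM.le).ofLE le_top) γ s)
    (hfut : IsFutureEndless γ s) (T₁ : ℝ) :
    ∃ σ ∈ s, T₁ < (Subtype.val ∘ γ) σ 0 -
      2 * M * Real.log (E4.spatialNorm ((Subtype.val ∘ γ) σ) / (2 * M) - 1) := by
  by_contra hcon
  push Not at hcon
  obtain ⟨σ₀, hσ₀⟩ := hfut.1
  have hη := minkowski_isFutureTimelikeCurveOn hM hγ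
  have hU := (strictMonoOn_retardedTime hM hs hγ).monotoneOn
  have hV := (strictMonoOn_advancedTime hM hs hγ).monotoneOn
  set c : ℝ → E4 := Subtype.val ∘ γ with hc
  set u₀ : ℝ := c σ₀ 0 - E4.spatialNorm (c σ₀) -
    4 * M * Real.log (E4.spatialNorm (c σ₀) / (2 * M) - 1) with hu₀
  set v₀ : ℝ := c σ₀ 0 + E4.spatialNorm (c σ₀) with hv₀
  -- `v ≤ 2T₁ − u₀` and `u ≤ 2T₁ − v₀` on the whole domain
  have hVle : ∀ σ ∈ s, c σ 0 + E4.spatialNorm (c σ) ≤ 2 * T₁ - u₀ := fun σ hσ ↦ by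
    rcases le_total σ₀ σ with h | h
    · have h1 := hU hσ₀ hσ h
      have h2 := hcon σ hσ
      simp only at h1
      linarith
    · have h1 := hV hσ hσ₀ h
      have h2 := hcon σ₀ hσ₀
      simp only at h1
      linarith
  have hUle : ∀ σ ∈ s, c σ 0 - E4.spatialNorm (c σ) -
      4 * M * Real.log (E4.spatialNorm (c σ) / (2 * M) - 1) ≤ 2 * T₁ - v₀ := fun σ hσ ↦ by
    rcases le_total σ₀ σ with h | h
    · have h1 := hV hσ₀ hσ h
      have h2 := hcon σ hσ
      simp only at h1
      linarith
    · have h1 := hU hσ hσ₀ h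
      have h2 := hcon σ₀ hσ₀
      simp only at h1
      linarith
  -- so `t* < v` is bounded above: the curve has a future endpoint `p` in `E4` ...
  have hB : ∀ σ ∈ s, c σ 0 ≤ 2 * T₁ - u₀ := fun σ hσ ↦ by
    have h := hVle σ hσ
    have hr : 0 ≤ E4.spatialNorm (c σ) := E4.spatialNorm_nonneg _
    linarith
  obtain ⟨p, hp⟩ := exists_hasFutureEndpoint_of_time_le hs ⟨σ₀, hσ₀⟩ hη hB
  -- ... which lies in the exterior, since `u` stays bounded above
  haveI : Nonempty s := ⟨⟨σ₀, hσ₀⟩⟩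
  have hp' : 2 * M < E4.spatialNorm p :=
    lt_spatialNorm_of_tendsto hM hp (fun σ ↦ (mem_region_iff hM.le).1 (γ σ).2)
      (Eventually.of_forall fun σ ↦ hUle σ σ.2)
  exact hfut.2 ⟨p, (mem_region_iff hM.le).2 hp'⟩ (hasFutureEndpoint_subtypeVal_comp_iff.1 hp)

/-- **Static time is unbounded below along a past endless timelike curve of the exterior.**
If `t ≥ T₀` on the domain then towards the past `u ≤ u₀`, `v ≥ 2T₀ − u₀`, and `t*` is bounded
below (`t* ≥ T₀` where `r ≥ 4M`, `t* > v − 4M` where `r < 4M`), so the curve converges in `E4`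
towards its past end (`exists_hasPastEndpoint_of_le_time`) to a point of `{r > 2M}`
(`lt_spatialNorm_of_tendsto`, `u ≤ u₀` eventually): a past endpoint, contradicting endlessness.
O'Neill 1983, Ch. 14, Def. 14.28; Wald 1984, §6.4. -/
theorem exists_staticTime_lt {M : ℝ} [Kerr.Facts] (hM : 0 < M)
    {γ : ℝ → Kerr.region 0 (Kerr.rPlus M 0)} {s : Set ℝ} (hs : s.OrdConnected)
    (hγ : (Kerr.smoothMetric M 0 (Kerr.rPlus M 0)).IsFutureTimelikeCurveOn
      ((Kerr.timeOrientation M 0 (Kerr.rPlus M 0) hM.le).ofLE le_top) γ s)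
    (hpast : IsPastEndless γ s) (T₀ : ℝ) :
    ∃ σ ∈ s, (Subtype.val ∘ γ) σ 0 -
      2 * M * Real.log (E4.spatialNorm ((Subtype.val ∘ γ) σ) / (2 * M) - 1) < T₀ := by
  by_contra hcon
  push Not at hcon
  obtain ⟨σ₀, hσ₀⟩ := hpast.1
  have hη := minkowski_isFutureTimelikeCurveOn hM hγ
  have hU := (strictMonoOn_retardedTime hM hs hγ).monotoneOn
  have ht := (Minkowski.strictMonoOn_time hs hη).monotoneOn
  set c : ℝ → E4 := Subtype.val ∘ γ with hc
  set u₀ : ℝ := c σ₀ 0 - E4.spatialNorm (c σ₀) -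
    4 * M * Real.log (E4.spatialNorm (c σ₀) / (2 * M) - 1) with hu₀
  -- `t*` is bounded below on the domain
  have hB : ∀ σ ∈ s, min (c σ₀ 0) (min T₀ (2 * T₀ - u₀ - 4 * M)) ≤ c σ 0 := fun σ hσ ↦ by
    rcases le_total σ₀ σ with h | h
    · exact (min_le_left _ _).trans (ht hσ₀ hσ h)
    · refine (min_le_right _ _).trans ?_
      have h1 := hU hσ hσ₀ h
      have h2 := hcon σ hσ
      simp only at h1
      have hr : 2 * M < E4.spatialNorm (c σ) := (mem_region_iff hM.le).1 (γ σ).2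
      by_cases h4 : 4 * M ≤ E4.spatialNorm (c σ)
      · refine (min_le_left _ _).trans ?_
        have hlog : 0 ≤ Real.log (E4.spatialNorm (c σ) / (2 * M) - 1) := by
          refine Real.log_nonneg ?_
          rw [le_sub_iff_add_le, le_div_iff₀ (by linarith)]
          linarith
        nlinarith [mul_nonneg hM.le hlog]
      · push Not at h4
        refine (min_le_right _ _).trans ?_
        linarith
  obtain ⟨p, hp⟩ := exists_hasPastEndpoint_of_le_time hs ⟨σ₀, hσ₀⟩ hη hB
  -- the past endpoint lies in the exterior, since `u ≤ u₀` towards the past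
  haveI : Nonempty s := ⟨⟨σ₀, hσ₀⟩⟩
  have hev : ∀ᶠ σ : s in atBot, c σ 0 - E4.spatialNorm (c σ) -
      4 * M * Real.log (E4.spatialNorm (c σ) / (2 * M) - 1) ≤ u₀ := by
    filter_upwards [eventually_le_atBot (⟨σ₀, hσ₀⟩ : s)] with σ hσ
    have h1 := hU σ.2 hσ₀ hσ
    simpa only using h1
  have hp' : 2 * M < E4.spatialNorm p :=
    lt_spatialNorm_of_tendsto hM hp (fun σ ↦ (mem_region_iff hM.le).1 (γ σ).2) hev
  exact hpast.2 ⟨p, (mem_region_iff hM.le).2 hp'⟩ (hasPastEndpoint_subtypeVal_comp_iff.1 hp)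

/-! ## The image of the static slice map is the level set `{t = 0}` -/

/-- **The static slice is `{t = 0}`.** A point `x` of the exterior `{r > 2M}` is in the image of the
static slice map `ψ(y) = (2M log(ρ(1 + M/2ρ)²/2M − 1), (1 + M/2ρ)² y)`, `ρ = ‖y‖ > M/2`, iff its
static time `x⁰ − 2M log(r/2M − 1)` vanishes: the areal radius `r = ρ(1 + M/2ρ)²` of `ψ(y)` gives
`⇒`; conversely `ρ = (r − M + √(r² − 2Mr))/2 > M/2` solves `ρ(1 + M/2ρ)² = r`, and
`y = (ρ/r) x⃗` is a preimage. Misner–Thorne–Wheeler 1973, §31.7, (31.22); Wald 1984, §6.4. -/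
theorem mem_range_iff_staticTime {M : ℝ} (hM : 0 < M)
    (ψ : Schwarzschild.isotropicExterior M → Kerr.region 0 (Kerr.rPlus M 0))
    (hψ : ∀ y, (ψ y : E4) =
      E4.ofTimeSpace (2 * M * Real.log (‖(y : E3)‖ * (1 + M / (2 * ‖(y : E3)‖)) ^ 2 / (2 * M) - 1))
        ((1 + M / (2 * ‖(y : E3)‖)) ^ 2 • (y : E3)))
    (x : Kerr.region 0 (Kerr.rPlus M 0)) :
    x ∈ range ψ ↔ (x : E4) 0 - 2 * M * Real.log (E4.spatialNorm (x : E4) / (2 * M) - 1) = 0 := by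
  constructor
  · rintro ⟨y, rfl⟩
    rw [hψ y, E4.ofTimeSpace_apply_zero, E4.spatialNorm_ofTimeSpace, norm_smul,
      Real.norm_of_nonneg (sq_nonneg _), mul_comm ((1 + M / (2 * ‖(y : E3)‖)) ^ 2)]
    ring
  · intro hx
    have hr : 2 * M < E4.spatialNorm (x : E4) := (mem_region_iff hM.le).1 x.2
    set r := E4.spatialNorm (x : E4) with hr_def
    have hr0 : 0 < r := by linarith
    have hD2 : 0 < r ^ 2 - 2 * M * r := by nlinarith
    set D := Real.sqrt (r ^ 2 - 2 * M * r) with hD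
    have hD0 : 0 < D := Real.sqrt_pos.2 hD2
    have hDsq : D ^ 2 = r ^ 2 - 2 * M * r := Real.sq_sqrt hD2.le
    -- the isotropic radius `ρ > M/2` with areal radius `r`
    set ρ := (r - M + D) / 2 with hρ
    have hρM : M / 2 < ρ := by
      rw [hρ]
      linarith
    have hρ0 : 0 < ρ := by linarith
    have hkey : ρ * (1 + M / (2 * ρ)) ^ 2 = r := by
      have h1 : ρ * (1 + M / (2 * ρ)) ^ 2 = (2 * ρ + M) ^ 2 / (4 * ρ) := by
        field_simp
        ring
      have h2 : 2 * ρ + M = r + D := by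
        rw [hρ]
        ring
      rw [h1, h2, div_eq_iff (by positivity), hρ]
      linear_combination hDsq
    set y : E3 := (ρ / r) • E4.spatial (x : E4) with hy
    have hny : ‖y‖ = ρ := by
      rw [hy, norm_smul, Real.norm_of_nonneg (by positivity)]
      change ρ / r * r = ρ
      field_simp
    have hymem : y ∈ Schwarzschild.isotropicExterior M := by
      rw [Schwarzschild.mem_isotropicExterior, hny]
      exact hρM
    refine ⟨⟨y, hymem⟩, Subtype.ext ?_⟩
    rw [hψ]
    change E4.ofTimeSpace (2 * M * Real.log (‖y‖ * (1 + M / (2 * ‖y‖)) ^ 2 / (2 * M) - 1))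
        ((1 + M / (2 * ‖y‖)) ^ 2 • y) = (x : E4)
    rw [hny, hkey]
    conv_rhs => rw [← E4.ofTimeSpace_time_spatial (x : E4)]
    congr 1
    · rw [E4.time_apply]
      linarith
    · rw [hy, smul_smul]
      have h1 : (1 + M / (2 * ρ)) ^ 2 * (ρ / r) = 1 := by
        calc (1 + M / (2 * ρ)) ^ 2 * (ρ / r) = ρ * (1 + M / (2 * ρ)) ^ 2 / r := by ring
          _ = 1 := by rw [hkey, div_self hr0.ne']
      rw [h1, one_smul]

end SheetCauchy

/-! ## The registered stub -/

open SheetCauchy in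
/-- **Stub `stub_sheetCauchy` of the line `Sketch` (throat-settles-too): the static slice is a
Cauchy hypersurface of the Kerr–Schild Schwarzschild exterior.**  For `M > 0` and any map `ψ` of
the open isotropic sheet `{‖y‖ > M/2}` into `Kerr.region 0 (Kerr.rPlus M 0) = {r > 2M}` given by
`ψ(y) = (2M log(r/2M − 1), (1 + M/2ρ)² y)`, the image `range ψ` — the slice `{t = 0}` of static
time `t = t* − 2M log(r/2M − 1)` (`mem_range_iff_staticTime`) — is met exactly once by every
endless timelike curve of `(Kerr.region 0 2M, g_{M,0}, −g♯dt*)`: along such a curve `t` is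
continuous and strictly increasing (`strictMonoOn_continuousOn_staticTime`) and unbounded above
and below (`exists_lt_staticTime`, `exists_staticTime_lt`), so it vanishes at exactly one
parameter (intermediate value theorem).  Kruskal 1960; O'Neill 1983, Ch. 14, Def. 14.28;
Wald 1984, §6.4; Hawking–Ellis 1973, §5.5. -/
theorem stub_sheetCauchy :
  ∀ [Kerr.Facts] (M : ℝ) (hM : 0 < M)
    (ψ : Schwarzschild.isotropicExterior M → Kerr.region 0 (Kerr.rPlus M 0)),
    (∀ y, (ψ y : E4) =
      E4.ofTimeSpace (2 * M * Real.log (‖(y : E3)‖ * (1 + M / (2 * ‖(y : E3)‖)) ^ 2 / (2 * M) - 1))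
        ((1 + M / (2 * ‖(y : E3)‖)) ^ 2 • (y : E3))) →
    (Kerr.smoothMetric M 0 (Kerr.rPlus M 0)).IsCauchyHypersurface
      ((Kerr.timeOrientation M 0 (Kerr.rPlus M 0) hM.le).ofLE le_top) (Set.range ψ) := by
  intro _ M hM ψ hψ γ s hγ
  obtain ⟨hs, hγt, hfut, hpast⟩ := hγ
  obtain ⟨hmono, hcont⟩ := strictMonoOn_continuousOn_staticTime hM hs hγt
  obtain ⟨a, ha, ha0⟩ := exists_staticTime_lt hM hs hγt hpast 0
  obtain ⟨b, hb, hb0⟩ := exists_lt_staticTime hM hs hγt hfut 0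
  obtain ⟨σ, hσ, hσ0⟩ := hs.isPreconnected.intermediate_value ha hb hcont ⟨ha0.le, hb0.le⟩
  refine ⟨σ, ⟨hσ, (mem_range_iff_staticTime hM ψ hψ _).2 hσ0⟩, ?_⟩
  rintro t ⟨ht, htS⟩
  exact hmono.injOn ht hσ (((mem_range_iff_staticTime hM ψ hψ _).1 htS).trans hσ0.symm)


end Summit.FinalStateConjecture.FinalStateConjecture.Theorems.SwallowTheDatum.UniversalWitnessFamily

end
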